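import Summits.ResolutionOfSingularities.ResolutionOfSingularities.Theses.Descent
import Literature.AlgebraicGeometry.Resolution.DiscreteSeparableResidueLocalUniformization
import Literature.AlgebraicGeometry.Resolution.LocalUniformization
import Literature.AlgebraicGeometry.Resolution.ResolutionLU
import Summits.ResolutionOfSingularities.ResolutionOfSingularities.Theorems.WeightedInvariantDescentPerfectToAllKummerCriterion
import Literature.AlgebraicGeometry.Resolution.RootAdjunctionRegular
import HarnessLib

/-!
# Frame ascent — function-first Frobenius frame for rung 1 `DiscreteInseparableResidueLU`
(lens-3 g6 sketch for crux `DescentPerfectToAll`, item stmt-ResolutionOfSingularities-0549;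
sub-line of the registered line `Lines/valuative_constant_step.lean`; counted 0 — nothing here
proves resolution in characteristic `p`).

RUNG 1 (restated verbatim from `Lines/valuative_constant_step.lean`, namespace
`…Cruxes.DescentPerfectToAll.ValuativeConstantStep`, not built on the farm): relative local
uniformization over an imperfect ground field `k` at a DISCRETE rank-one place whose residues are
purely inseparable over `k` and not all in `k`.

LEVER. A FRAME of `(K | k, O)` is an intermediate field `k ⊆ M ⊆ K` that is RESIDUALLY RATIONAL
(every residue of `O ∩ M` lies in `k`) with `K / M` purely inseparable. Frames always exist
(`M = k·K^{p^n}(ρ)`, `ρ` a uniformizer). The frame is DEFECTLESS when `O` is a finitely generated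
`O ∩ M`-module (valuation basis; `[K:M] = e·f`). THEOREM A (this sketch's assembly
`FrameDefectlessLU_of`): a defectless frame gives `RelLocalUniformization k K O`, by
(bottom) Knaf–Kuhlmann 2009 Thm 1.5 on `M ⊆ k((ρ))` — the tree's NAMED FACT
`KnafKuhlmann2009MonogenicCompletion` with `y := ρ` — and (ascent) a tower of degree-`p` steps
each RAMIFIED (`z^p` a uniformizer: `A[z] = A[Z]/(Z^p - π)` regular) or INERT (`y^p = u` a unit
whose residue is not a `p`-th power of a residue: `A[y] = A[Y]/(Y^p - u)` has FIELD fibre, hence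
is regular) — never immediate. No derivation, no descent, no base change, no constant swap: the
ground field `k` is kept and only the FUNCTION subfield changes (Disproof.lean §3, §8, §10 honoured:
the models are regular, not smooth).

RESIDUAL. `FrameDefectLU p` = rung 1 on the fields with NO defectless frame (they exist inside
S1 with simple residue field, e.g. `K = k(x, θ + a(x), θ·g(x) + h(x)) ⊂ k(θ)((x))`, generic
`a g h ∈ k[[x]]`): immediate purely inseparable FUNCTION steps over a discrete base with
inseparable residue field — Kuhlmann's (dependent) defect; Knaf–Kuhlmann cannot enter there
(KK 2009 Thm 1.6, Lemma 3.12). `rung_split` / `sub_rung_*`: rung 1 ⟺ both halves.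
-/

open Literature.AlgebraicGeometry.Resolution

namespace Summit.ResolutionOfSingularities.ResolutionOfSingularities.Cruxes.DescentPerfectToAll.FrameAscent

/-- RUNG 1, verbatim copy of `ValuativeConstantStep.DiscreteInseparableResidueLU`. -/
def DiscreteInseparableResidueLU (p : ℕ) : Prop :=
  ∀ (k K : Type) [Field k] [CharP k p] [Field K] [Algebra k K], (⊤ : IntermediateField k K).FG →
    ∀ O : ValuationSubring K, (∀ c : k, algebraMap k K c ∈ O) → IsDiscreteValuationRing O →
      (∀ t : K, t ∈ O → ∃ (c : k) (n : ℕ), O.valuation (t ^ p ^ n - algebraMap k K c) < 1) →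
      (∃ t : K, t ∈ O ∧ ∀ c : k, 1 ≤ O.valuation (t - algebraMap k K c)) →
        RelLocalUniformization k K O

/-! ## Vocabulary (everything inside the one ambient field `K`; no coercions of subfields to types
except through `IntermediateField`) -/

/-- `L` is RESIDUALLY RATIONAL for `O` over `k`: every element of `O ∩ L` is congruent to a
constant of `k` modulo the maximal ideal. -/
def ResiduallyRationalOn (k : Type) {K : Type} [Field k] [Field K] [Algebra k K]
    (O : ValuationSubring K) (L : IntermediateField k K) : Prop :=
  ∀ t : K, t ∈ L → t ∈ O → ∃ c : k, O.valuation (t - algebraMap k K c) < 1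

/-- `K / M` is purely inseparable of some finite exponent at every element. -/
def PurelyInseparableOver (p : ℕ) {k K : Type} [Field k] [Field K] [Algebra k K]
    (M : IntermediateField k K) : Prop :=
  ∀ t : K, ∃ n : ℕ, t ^ p ^ n ∈ M

/-- DEFECTLESS frame data: `O` is generated as an `O ∩ M`-module by a finite set `s ⊆ O`
(for a discrete `O ∩ M` and finite `K/M` this is `[K:M] = e·f`, a valuation basis). -/
def HasIntegralBasisOver {k K : Type} [Field k] [Field K] [Algebra k K]
    (O : ValuationSubring K) (M : IntermediateField k K) : Prop :=
  ∃ s : Finset K, (∀ b ∈ s, b ∈ O) ∧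
    ∀ t : K, t ∈ O → ∃ m : K → K, (∀ b ∈ s, m b ∈ O ∧ m b ∈ M) ∧ t = s.sum (fun b => m b * b)

/-- `(K | k, O)` admits a DEFECTLESS residually-rational purely-inseparable FRAME. -/
def HasDefectlessFrame (p : ℕ) (k K : Type) [Field k] [Field K] [Algebra k K]
    (O : ValuationSubring K) : Prop :=
  ∃ M : IntermediateField k K, ResiduallyRationalOn k O M ∧ PurelyInseparableOver p M ∧
    HasIntegralBasisOver O M

/-- Relative local uniformization INSIDE the intermediate field `L` (all objects are subalgebras of
the ambient `K`; regularity is tested at the centre of `O`, exactly as in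
`RelLocalUniformization`). The induction invariant `P(L)` of the ascent. -/
def LUIn (k : Type) {K : Type} [Field k] [Field K] [Algebra k K]
    (O : ValuationSubring K) (L : IntermediateField k K) : Prop :=
  ∀ R : Subalgebra k K, R.FG → R ≤ L.toSubalgebra → R.toSubring ≤ O.toSubring →
    ∃ (A : Subalgebra k K) (h : A.toSubring ≤ O.toSubring), R ≤ A ∧ A ≤ L.toSubalgebra ∧ A.FG ∧
      IsRegularLocalRing
        (Localization.AtPrime (Ideal.comap (Subring.inclusion h) (IsLocalRing.maximalIdeal O)))

/-- Glue (proved): the invariant at the top field is relative local uniformization. -/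
theorem relLU_of_luIn_top {k K : Type} [Field k] [Field K] [Algebra k K]
    (O : ValuationSubring K) (h : LUIn k O ⊤) : RelLocalUniformization k K O := by
  intro R hR _hfrac hRO
  have hle : R ≤ (⊤ : IntermediateField k K).toSubalgebra := by
    intro x _hx
    exact (IntermediateField.mem_toSubalgebra _ _).2 IntermediateField.mem_top
  obtain ⟨A, hA, hRA, -, hAfg, hreg⟩ := h R hR hle hRO
  exact ⟨A, hA, hRA, hAfg, hreg⟩

/-! ## The two halves of rung 1 -/

/-- SUB-RUNG (easy half): rung 1 restricted to places with a defectless frame. -/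
def FrameDefectlessLU (p : ℕ) : Prop :=
  ∀ (k K : Type) [Field k] [CharP k p] [Field K] [Algebra k K], (⊤ : IntermediateField k K).FG →
    ∀ O : ValuationSubring K, (∀ c : k, algebraMap k K c ∈ O) → IsDiscreteValuationRing O →
      (∀ t : K, t ∈ O → ∃ (c : k) (n : ℕ), O.valuation (t ^ p ^ n - algebraMap k K c) < 1) →
      (∃ t : K, t ∈ O ∧ ∀ c : k, 1 ≤ O.valuation (t - algebraMap k K c)) →
      HasDefectlessFrame p k K O →
        RelLocalUniformization k K O

/-- RESIDUAL (hard half, the typed obstruction cell): rung 1 at places with FRAME DEFECT — no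
defectless residually-rational purely-inseparable frame exists. Mathematically: somewhere in every
frame tower an IMMEDIATE purely inseparable function step `L ⊂ L(w)`, `w ∈ L̂ ∖ L`, `w^p ∈ L`,
over a discrete base `L` with inseparable residue field (Kuhlmann's dependent defect). -/
def FrameDefectLU (p : ℕ) : Prop :=
  ∀ (k K : Type) [Field k] [CharP k p] [Field K] [Algebra k K], (⊤ : IntermediateField k K).FG →
    ∀ O : ValuationSubring K, (∀ c : k, algebraMap k K c ∈ O) → IsDiscreteValuationRing O →
      (∀ t : K, t ∈ O → ∃ (c : k) (n : ℕ), O.valuation (t ^ p ^ n - algebraMap k K c) < 1) →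
      (∃ t : K, t ∈ O ∧ ∀ c : k, 1 ≤ O.valuation (t - algebraMap k K c)) →
      ¬ HasDefectlessFrame p k K O →
        RelLocalUniformization k K O

theorem sub_rung_frameDefectless {p : ℕ} (h : DiscreteInseparableResidueLU p) :
    FrameDefectlessLU p :=
  fun k K _ _ _ _ hfg O hk hO hres hne _ => h k K hfg O hk hO hres hne

theorem sub_rung_frameDefect {p : ℕ} (h : DiscreteInseparableResidueLU p) : FrameDefectLU p :=
  fun k K _ _ _ _ hfg O hk hO hres hne _ => h k K hfg O hk hO hres hne

/-- Rung 1 is exactly the conjunction of its two halves. -/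
theorem rung_split {p : ℕ} (h₁ : FrameDefectlessLU p) (h₂ : FrameDefectLU p) :
    DiscreteInseparableResidueLU p := by
  intro k K _ _ _ _ hfg O hk hO hres hne
  by_cases hF : HasDefectlessFrame p k K O
  · exact h₁ k K hfg O hk hO hres hne hF
  · exact h₂ k K hfg O hk hO hres hne hF

theorem rung_iff (p : ℕ) :
    DiscreteInseparableResidueLU p ↔ (FrameDefectlessLU p ∧ FrameDefectLU p) :=
  ⟨fun h => ⟨sub_rung_frameDefectless h, sub_rung_frameDefect h⟩, fun h => rung_split h.1 h.2⟩

/-! ## Stubs of the easy half (stated as `Prop`s; the assembly below is kernel-checked) -/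

/-- STUB A1 (M) — FRAME BOTTOM. A residually rational `M` under a discrete `O` with `K/M` purely
inseparable: `O ∩ M` is a DVR with a uniformizer `ρ ∈ M`, every element of `M` is a Laurent
series in `ρ` with coefficients in `k` to any precision (`IsDenseOver k (O∩M) ρ`), the residue of
`ρ` is `0` (`HasSeparableResidue` via `μ = X`); so `KnafKuhlmann2009MonogenicCompletion`
(KK 2009 Thm 1.5, bullet 1) gives relative local uniformization of `M`, i.e. `LUIn k O M`
(enlarge a given `R ⊆ O ∩ M` by generators of `M` first). -/
def FrameBottom (p : ℕ) : Prop :=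
  KnafKuhlmann2009MonogenicCompletion →
  ∀ (k K : Type) [Field k] [CharP k p] [Field K] [Algebra k K], (⊤ : IntermediateField k K).FG →
    ∀ O : ValuationSubring K, (∀ c : k, algebraMap k K c ∈ O) → IsDiscreteValuationRing O →
    ∀ M : IntermediateField k K, ResiduallyRationalOn k O M → PurelyInseparableOver p M →
      LUIn k O M

/-- STUB A2 (M) — INERT STEP ASCENT. `y ∈ O`, `y^p ∈ L`, and `y` is congruent to NO element of
`L` modulo the maximal ideal (so `y` is a unit, `ȳ ∉ κ_L`, `[L(y):L] = p`, `f = p`,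
`O ∩ L(y) = ⊕ (O ∩ L)·yⁱ`). Given a regular local `A ⊆ O ∩ L` essentially of finite type
containing `u := y^p` and the `O ∩ L`-coordinates of the target elements: `A[y] = A[Y]/(Y^p-u)`,
the fibre `κ(A)[Y]/(Y^p - ū)` is a field (`ū ∉ κ_L^p ⊇ κ(A)^p`), so `A[y]` is local with
maximal ideal `𝔪_A·A[y]` on `dim A` generators: regular. -/
def InertStepAscent (p : ℕ) : Prop :=
  ∀ (k K : Type) [Field k] [CharP k p] [Field K] [Algebra k K],
    ∀ O : ValuationSubring K, (∀ c : k, algebraMap k K c ∈ O) → IsDiscreteValuationRing O →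
    ∀ (L : IntermediateField k K) (y : K), y ∈ O → y ^ p ∈ L →
      (∀ e : K, e ∈ L → 1 ≤ O.valuation (y - e)) →
      LUIn k O L → LUIn k O (L ⊔ IntermediateField.adjoin k {y})

/-- STUB A3 (M) — RAMIFIED STEP ASCENT. `z ∈ O`, `z^p ∈ L`, and the value of `z` is the value
of NO element of `L` (so `e = p`, `[L(z):L] = p`, `O ∩ L(z) = ⊕ (O ∩ L)·zⁱ` after rescaling
`z` to minimal positive value, and then `π := z^p` generates the maximal ideal of `O ∩ L`).
Given a regular local `A ⊆ O ∩ L` dominated by `O` and containing `π`: `v(𝔪_A²) ≥ 2·v(π)` forces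
`π ∉ 𝔪_A²`, so `π` is a regular parameter and `A[z] = A[Z]/(Z^p - π)` is regular with parameters
`(z, t₂, …, t_d)`. -/
def RamifiedStepAscent (p : ℕ) : Prop :=
  ∀ (k K : Type) [Field k] [CharP k p] [Field K] [Algebra k K],
    ∀ O : ValuationSubring K, (∀ c : k, algebraMap k K c ∈ O) → IsDiscreteValuationRing O →
    ∀ (L : IntermediateField k K) (z : K), z ∈ O → z ^ p ∈ L →
      (∀ b : K, b ∈ L → O.valuation z ≠ O.valuation b) →
      LUIn k O L → LUIn k O (L ⊔ IntermediateField.adjoin k {z})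

/-- STUB A4 (M) — DEFECTLESS TOWER INDUCTION. A finite purely inseparable `K/M` with an integral
basis (defectless over the DVR `O ∩ M`) is climbed by degree-`p` steps each of which is INERT or
RAMIFIED in the normal forms of A2/A3 (a degree-`p` subextension of a defectless extension is
defectless, and `p = e·f` leaves `e = p` or `f = p`; never immediate). Stated as an induction
principle for predicates on intermediate fields. -/
def DefectlessTowerInduction (p : ℕ) : Prop :=
  ∀ (k K : Type) [Field k] [CharP k p] [Field K] [Algebra k K], (⊤ : IntermediateField k K).FG →
    ∀ O : ValuationSubring K, IsDiscreteValuationRing O →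
    ∀ M : IntermediateField k K, PurelyInseparableOver p M → HasIntegralBasisOver O M →
    ∀ P : IntermediateField k K → Prop, P M →
      (∀ (L : IntermediateField k K) (y : K), M ≤ L → y ∈ O → y ^ p ∈ L →
          (∀ e : K, e ∈ L → 1 ≤ O.valuation (y - e)) → P L →
            P (L ⊔ IntermediateField.adjoin k {y})) →
      (∀ (L : IntermediateField k K) (z : K), M ≤ L → z ∈ O → z ^ p ∈ L →
          (∀ b : K, b ∈ L → O.valuation z ≠ O.valuation b) → P L →
            P (L ⊔ IntermediateField.adjoin k {z})) →
      P ⊤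

/-- ASSEMBLY of the easy half (kernel-checked, no `sorry`): the NAMED FACT
`KnafKuhlmann2009MonogenicCompletion` (shared with `stub_knafKuhlmann2009` of the registered line)
and the four M-sized stubs give `FrameDefectlessLU p`. -/
theorem FrameDefectlessLU_of {p : ℕ} (hKK : KnafKuhlmann2009MonogenicCompletion)
    (h₁ : FrameBottom p) (h₂ : InertStepAscent p) (h₃ : RamifiedStepAscent p)
    (h₄ : DefectlessTowerInduction p) : FrameDefectlessLU p := by
  intro k K _ _ _ _ hfg O hk hO _hres _hne hframe
  obtain ⟨M, hrat, hpi, hbasis⟩ := hframe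
  have htop : LUIn k O ⊤ :=
    h₄ k K hfg O hO M hpi hbasis (LUIn k O) (h₁ hKK k K hfg O hk hO M hrat hpi)
      (fun L y _ hy hyp hye hL => h₂ k K O hk hO L y hy hyp hye hL)
      (fun L z _ hz hzp hzv hL => h₃ k K O hk hO L z hz hzp hzv hL)
  exact relLU_of_luIn_top O htop

/-- How the easy half plugs into rung 1: with the residual `FrameDefectLU p` it IS rung 1. -/
theorem rung_of_stubs {p : ℕ} (hKK : KnafKuhlmann2009MonogenicCompletion)
    (h₁ : FrameBottom p) (h₂ : InertStepAscent p) (h₃ : RamifiedStepAscent p)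
    (h₄ : DefectlessTowerInduction p) (h₅ : FrameDefectLU p) : DiscreteInseparableResidueLU p :=
  rung_split (FrameDefectlessLU_of hKK h₁ h₂ h₃ h₄) h₅

/-! ## ∀p-closures for the crux probe (BC7-style) -/

def FrameDefectlessLUAll : Prop := ∀ p : ℕ, p.Prime → FrameDefectlessLU p
def FrameDefectLUAll : Prop := ∀ p : ℕ, p.Prime → FrameDefectLU p
def RungOneAll : Prop := ∀ p : ℕ, p.Prime → DiscreteInseparableResidueLU p
def InertStepAscentAll : Prop := ∀ p : ℕ, p.Prime → InertStepAscent p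
def RamifiedStepAscentAll : Prop := ∀ p : ℕ, p.Prime → RamifiedStepAscent p
def DefectlessTowerInductionAll : Prop := ∀ p : ℕ, p.Prime → DefectlessTowerInduction p
def FrameBottomAll : Prop := ∀ p : ℕ, p.Prime → FrameBottom p

/-! ## 8. The local algebra of the ascent steps is ALREADY LANDED (g6 addendum)

* INERT core (stub A2): `Theorems.KummerCriterion.isRegularLocalRing_of_forall_not_mem` —
  `(∀ c, a - c^p ∉ 𝔪_A) → IsRegularLocalRing (AdjoinRoot (X^p - C a))` (with `𝔪_B = 𝔪_A B`,
  `isLocalRing_of_forall_not_mem`), landed in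
  `Theorems/WeightedInvariantDescentPerfectToAllKummerCriterion.lean` (line root-of-a-constant, stub E).
* RAMIFIED core (stub A3): `Literature.AlgebraicGeometry.Resolution.AdjoinRoot.isRegularLocalRing_X_pow_sub_C`
  (root of a regular parameter; CP 2008 Prop. 4.4 auxiliary ring), or — as below, in ten lines — the landed
  Kummer criterion `Theorems.stub_kummerCriterion` (`IsRegularLocalRing (AdjoinRoot (X^p - C a)) ↔ ∀ c, a - c^p ∉ 𝔪²`).
So A2/A3 are NORMAL-FORM BOOKKEEPING (coefficients of `Σ eᵢ yⁱ ∈ O` lie in `O` by residue- resp.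
value-independence of `1, y, …, y^{p-1}` over `L`) + localization plumbing around these two theorems. -/

/-- RAMIFIED core of stub A3 from the landed Kummer criterion: a regular parameter `π ∈ 𝔪 ∖ 𝔪²`
of a regular local ring of characteristic `p` satisfies `π - c^p ∉ 𝔪²` for every `c`, hence
`A[Z]/(Z^p - π)` is a regular local ring. [this file, from `Theorems.stub_kummerCriterion`] -/
theorem ramifiedStep_core (p : ℕ) [Fact p.Prime] (A : Type) [CommRing A] [IsRegularLocalRing A]
    [CharP A p] (π : A) (hπ : π ∈ IsLocalRing.maximalIdeal A)
    (hπ2 : π ∉ IsLocalRing.maximalIdeal A ^ 2) :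
    IsRegularLocalRing (AdjoinRoot (Polynomial.X ^ p - Polynomial.C π : Polynomial A)) := by
  refine (Summit.ResolutionOfSingularities.ResolutionOfSingularities.Theorems.stub_kummerCriterion
    p A π).mpr ?_
  intro c hc
  have hp : p.Prime := Fact.out
  by_cases hcm : c ∈ IsLocalRing.maximalIdeal A
  · -- `c^p ∈ 𝔪^p ⊆ 𝔪²`, so `π = (π - c^p) + c^p ∈ 𝔪²`
    have hcp : c ^ p ∈ IsLocalRing.maximalIdeal A ^ 2 :=
      Ideal.pow_le_pow_right hp.two_le (Ideal.pow_mem_pow hcm p)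
    exact hπ2 (by simpa using Ideal.add_mem _ hc hcp)
  · -- `c` is a unit, so `π - c^p ∉ 𝔪 ⊇ 𝔪²`
    have hmem : π - c ^ p ∈ IsLocalRing.maximalIdeal A :=
      Ideal.pow_le_self (two_ne_zero) hc
    have hcp : c ^ p ∈ IsLocalRing.maximalIdeal A := by
      simpa using Ideal.sub_mem _ hπ hmem
    exact hcm (((IsLocalRing.maximalIdeal.isMaximal A).isPrime.pow_mem_iff_mem p hp.pos).mp hcp)

/-- INERT core of stub A2, by name (landed): `ā ∉ κ(A)^p ⟹ A[Y]/(Y^p - a)` regular local. -/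
theorem inertStep_core (p : ℕ) (hp : p.Prime) (A : Type) [CommRing A] [IsRegularLocalRing A]
    (a : A) (ha : ∀ c : A, a - c ^ p ∉ IsLocalRing.maximalIdeal A) :
    IsRegularLocalRing (AdjoinRoot (Polynomial.X ^ p - Polynomial.C a : Polynomial A)) :=
  Summit.ResolutionOfSingularities.ResolutionOfSingularities.Theorems.KummerCriterion.isRegularLocalRing_of_forall_not_mem
    hp ha

end Summit.ResolutionOfSingularities.ResolutionOfSingularities.Cruxes.DescentPerfectToAll.FrameAscent
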